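import Literature.AlgebraicGeometry.Motives.AbelianVarietyGoodReductionConjReductionPoint
import Literature.AlgebraicGeometry.Motives.AbelianVarietyConjugateTransport
import Literature.AlgebraicGeometry.Motives.ProperIntegralPointsFrobeniusTranslate
import HarnessLib

/-!
# Reading geometric points through the model of a good-reduction datum: the `Ω`-points of the model and of the twisted
# model underlying `y ∈ A(K̄)` and its `σ̃`-conjugate `y^σ̃ ∈ A^γ(K̄)` — [Shimura 1998, §18.6 proof of Thm. 18.6, p. 129]

Topic `Literature/AlgebraicGeometry/Motives`; namespaces `Literature.NumberTheory.DiophantineGeometry` (§0) and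
`Literature.AlgebraicGeometry.Motives.AbelianVariety.GoodReductionAt` (§1–§2).  THEOREMS ONLY (no definition, no named
fact; net Literature debt 0).  Cell `hodgecm-mathlib` (D-0151), row II-1, edition E4 «S5c′ ↦ Q5», Q5 background pool piece
**(G1) «generic readings»** (B-p09 RULING 4, 2026-08-28T10:31:56Z (2)): the inputs `hQ` / `hP'` of the slot (T3)
`reducePointMonoidHom_left_eq_frobenius_comp_of_frobeniusAt` (★ `ProperIntegralPointsFrobeniusTranslate`) for the (TW)
assembly.

WHAT IS HERE.  `K` a number field, `v` a finite place, `𝓞ᵥ = valuationSubringAtPrime K v`, `ι = absClosureEmbedding K K_v :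
K̄ → Ω`, `V = ℤ̄_{𝔓₀} = absIntegersValuationSubring (adicCompletionPrime K v)` with a structure map `f′ : 𝓞ᵥ → V` over
`K → K̄` (`hf'`), `S : B.GoodReductionAt v` ANY good-reduction datum (model `𝒳 = S.model.total`, generic isomorphism
`S.genericIso' : 𝒳_K ≅ B`).
* §0 `toAdicCompletionPoints_left` — `B(K̄) → B(Ω)` on underlying schemes is `Spec ι ≫ _`.
* §1 `exists_modelPoint_absIntegersValuationSubring` — the `K̄`-point `ξ_y : Spec (K̄; V, f′) → 𝒳` of the MODEL underlying
  `y ∈ B(K̄)`: `ξ_y.left = (y ≫ S.genericIso'⁻¹).left ≫ pr₁` (`pr₁ : 𝒳_K → 𝒳`); and **(G1a)**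
  `modelPointsEquiv_symm_toAdicCompletionPoints_left` — the `Ω`-point of `𝒳` attached to `y` by the reduction map
  (`S.modelPointsEquiv⁻¹ (ι_* y)`) lies over `Spec ι ≫ ξ_y` (the `hQ` of (T3)).
* §2 **(G1b)** `modelPointsEquiv_symm_conjTransport_left_comp_fst` — for the conjugate datum `R'.conjOfSquares γ γᵥ h₁ p n h₂`
  (model `𝒳 ⊗_{γᵥ} 𝓞ᵥ`, generic isomorphism through `conjGenericNatIso` and `γ^*(e)`) and `σ̃ : K̄ ≃+* K̄` over `γ`: the
  `Ω`-point of the twisted model attached to `y^σ̃ = conjTransport γ σ̃ hσa A y`, projected to `𝒳`, lies over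
  `Spec ι ≫ Spec σ̃ ≫ ξ_y` (the `hP'` of (T3)) — from ★ `conjTransport_left_comp_fst` («`x^σ̃` lies over `Spec σ̃ ≫ x`»),
  ★ `conjModel_genericIso_hom_left_comp_fst` / `conjGenericNatIso_hom_app_left_comp_fst_fst` and ★ `modelPointsEquiv_symm_left`;
  plus the `conjFrob` specialisation `…_conjFrob_…`.

HC_CM is proved only modulo the 7 printed citations until rung 0 closes.

## References
* [Shimura1998] G. Shimura, *Abelian Varieties with Complex Multiplication and Modular Functions*, Princeton 1998, §18.6
  proof of Thm. 18.6, p. 129 («`(Y^σ)~ = Ỹ^f` … the point `t^σ`»).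
* [GortzWedhorn2020] U. Görtz, T. Wedhorn, *Algebraic Geometry I* (2nd ed.), §(4.7) (points of a base change).
* [Hartshorne1977] R. Hartshorne, *Algebraic Geometry*, II.3 (fibre products).
-/

set_option autoImplicit false

noncomputable section

open CategoryTheory CategoryTheory.Limits AlgebraicGeometry IsDedekindDomain IsDedekindDomain.HeightOneSpectrum
open scoped NumberField
open Literature.NumberTheory.EllipticCurves (genericFibre specGenericPoint)
open Literature.NumberTheory.GaloisRepresentations
open Literature.NumberTheory.DiophantineGeometry

/-! ### §0 `B(K̄) → B(K̄ᵥ)` on underlying schemes -/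

namespace Literature.NumberTheory.DiophantineGeometry

open Literature.AlgebraicGeometry.Motives

variable {K : Type} [Field K] [NumberField K]

/-- `B(K̄) → B(Ω)` (`Ω = \bar K_v`, extension of scalars along the chosen `ι : K̄ → Ω`) on underlying schemes:
`(ι_* P).left = Spec ι ≫ P.left`. [cite: MumfordAV1970, §4 (functor of points)] -/
theorem toAdicCompletionPoints_left (B : AbelianVariety K) (v : HeightOneSpectrum (𝓞 K))
    (P : B.Points (AlgebraicClosure K)) :
    (toAdicCompletionPoints B v P).left =
      Spec.map (CommRingCat.ofHom (absClosureEmbedding K (v.adicCompletion K)).toRingHom) ≫ P.left :=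
  rfl

end Literature.NumberTheory.DiophantineGeometry

namespace Literature.AlgebraicGeometry.Motives

namespace AbelianVariety

namespace GoodReductionAt

variable {K : Type} [Field K] [NumberField K] {v : HeightOneSpectrum (𝓞 K)} {B : AbelianVariety K}

/-! ### §1 The `K̄`-point of the model underlying a geometric point, and (G1a) -/

set_option backward.isDefEq.respectTransparency false in
/-- **The `K̄`-point `ξ_y` of the model underlying `y ∈ B(K̄)`**, over the global valuation ring base point `(V, f′)`
(`V = ℤ̄_{𝔓₀}`, `f′ : 𝓞ᵥ → V` over `K → K̄`): an `𝓞ᵥ`-morphism `Spec (K̄; V, f′) → 𝒳` whose underlying map is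
`(y ≫ S.genericIso'⁻¹).left ≫ pr₁` — `y` read in the generic fibre `𝒳_K ≅ B`, then projected to `𝒳`.
[cite: Hartshorne1977, II.3 Thm. 3.3 (fibre product, universal property)] -/
theorem exists_modelPoint_absIntegersValuationSubring (S : B.GoodReductionAt v) [(adicCompletionPrime K v).IsMaximal]
    (f' : valuationSubringAtPrime K v →+* absIntegersValuationSubring (adicCompletionPrime K v))
    (hf' : ∀ x : valuationSubringAtPrime K v,
      ((f' x : absIntegersValuationSubring (adicCompletionPrime K v)) : AlgebraicClosure K) =
        algebraMap K (AlgebraicClosure K) (x : K))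
    (y : B.geomPoints) :
    ∃ ξ : specFractionField (absIntegersValuationSubring (adicCompletionPrime K v)) f' ⟶ S.model.total,
      ξ.left = (Additive.toMul y ≫ S.genericIso'.inv).left ≫
        pullback.fst S.model.total.hom (specGenericPoint (valuationSubringAtPrime K v) K) := by
  refine ⟨Over.homMk ((Additive.toMul y ≫ S.genericIso'.inv).left ≫
    pullback.fst S.model.total.hom (specGenericPoint (valuationSubringAtPrime K v) K)) ?_, rfl⟩
  have hw : (Additive.toMul y ≫ S.genericIso'.inv).left ≫
      ((genericFibre (valuationSubringAtPrime K v) K).obj S.model.total).hom =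
        (specOver K (AlgebraicClosure K)).hom := Over.w _
  have hcond : pullback.fst S.model.total.hom (specGenericPoint (valuationSubringAtPrime K v) K) ≫ S.model.total.hom =
      ((genericFibre (valuationSubringAtPrime K v) K).obj S.model.total).hom ≫
        specGenericPoint (valuationSubringAtPrime K v) K := pullback.condition
  have hring : (algebraMap (absIntegersValuationSubring (adicCompletionPrime K v)) (AlgebraicClosure K)).comp f' =
      (algebraMap K (AlgebraicClosure K)).comp (algebraMap (valuationSubringAtPrime K v) K) :=
    RingHom.ext fun x => hf' x
  change (_ ≫ _) ≫ S.model.total.hom = Spec.map _ ≫ Spec.map _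
  rw [← Spec.map_comp, ← CommRingCat.ofHom_comp, hring, CommRingCat.ofHom_comp, Spec.map_comp]
  exact ((Category.assoc _ _ _).trans (congrArg ((Additive.toMul y ≫ S.genericIso'.inv).left ≫ ·) hcond)).trans
    ((Category.assoc _ _ _).symm.trans (congrArg (· ≫ specGenericPoint (valuationSubringAtPrime K v) K) hw))

set_option backward.isDefEq.respectTransparency false in
/-- **(G1a) The `Ω`-point of the model attached to `y ∈ B(K̄)` lies over `Spec ι ≫ ξ_y`**: for ANY good-reduction datum
`S` of `B` at `v` and the model point `ξ_y` underlying `y` (`hξ`), the `Ω`-point `S.modelPointsEquiv⁻¹ (ι_* y)` of `𝒳`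
(the first layer of the reduction map `S.geomReductionMap`) has underlying map `Spec ι ≫ ξ_y.left` — the hypothesis `hQ`
of the slot (T3). [cite: Shimura1998, §18.6 proof of Thm. 18.6, p. 129] [cite: Hartshorne1977, II.3 Thm. 3.3 (fibre product, universal property)] -/
theorem modelPointsEquiv_symm_toAdicCompletionPoints_left (S : B.GoodReductionAt v) [(adicCompletionPrime K v).IsMaximal]
    (f' : valuationSubringAtPrime K v →+* absIntegersValuationSubring (adicCompletionPrime K v)) (y : B.geomPoints)
    (ξ : specFractionField (absIntegersValuationSubring (adicCompletionPrime K v)) f' ⟶ S.model.total)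
    (hξ : ξ.left = (Additive.toMul y ≫ S.genericIso'.inv).left ≫
      pullback.fst S.model.total.hom (specGenericPoint (valuationSubringAtPrime K v) K)) :
    (S.modelPointsEquiv.symm (toAdicCompletionPoints B v (Additive.toMul y))).left =
      Spec.map (CommRingCat.ofHom (absClosureEmbedding K (v.adicCompletion K)).toRingHom) ≫ ξ.left := by
  rw [modelPointsEquiv_symm_left, hξ, Over.comp_left, Over.comp_left, toAdicCompletionPoints_left]
  simp only [Category.assoc]

/-! ### §2 (G1b) The `Ω`-point of the twisted model attached to `y^σ̃` -/

variable {A : AbelianVariety K} (R' : A.GoodReductionAt v) (γ : K ≃+* K)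
  (γᵥ : valuationSubringAtPrime K v ≃+* valuationSubringAtPrime K v)
  (h₁ : (algebraMap (valuationSubringAtPrime K v) K).comp γᵥ.toRingHom =
    γ.toRingHom.comp (algebraMap (valuationSubringAtPrime K v) K))
  (p n : ℕ) [ExpChar v.asIdeal.ResidueField p]
  (h₂ : (residueAt v).comp γᵥ.toRingHom = (iterateFrobenius v.asIdeal.ResidueField p n).comp (residueAt v))
  (σt : AlgebraicClosure K ≃+* AlgebraicClosure K)
  (hσa : ∀ a : K, σt (algebraMap K (AlgebraicClosure K) a) = algebraMap K (AlgebraicClosure K) (γ a))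

set_option backward.isDefEq.respectTransparency false in
/-- **The INVERSE generic isomorphism of the conjugate model against the projections**:
`e_γ⁻¹.left ≫ pr ≫ pr_𝒳 = pr_A ≫ e⁻¹.left ≫ pr₁` — from the tree's `conjModel_genericIso_hom_left_comp_fst` and
`conjGenericNatIso_hom_app_left_comp_fst_fst` by cancelling the isomorphism `e_γ`. [cite: GortzWedhorn2020, Prop. 4.16 and §(4.7)] -/
theorem conjModel_genericIso_inv_left_comp_fst_fst :
    (conjModel R' γ γᵥ h₁).genericIso.inv.left ≫
        baseChangeHomFst (algebraMap (valuationSubringAtPrime K v) K) ((baseChangeHom γᵥ.toRingHom).obj R'.model.total) ≫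
          baseChangeHomFst γᵥ.toRingHom R'.model.total =
      baseChangeHomFst γ.toRingHom A.X ≫ R'.model.genericIso.inv.left ≫
        baseChangeHomFst (algebraMap (valuationSubringAtPrime K v) K) R'.model.total := by
  rw [← cancel_epi (conjModel R' γ γᵥ h₁).genericIso.hom.left, ← Over.comp_left_assoc, Iso.hom_inv_id, Over.id_left,
    Category.id_comp, ← conjGenericNatIso_hom_app_left_comp_fst_fst γ γᵥ h₁ R'.model.total,
    conjModel_genericIso_hom_left_comp_fst_assoc, ← Over.comp_left_assoc, Iso.hom_inv_id, Over.id_left, Category.id_comp]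

set_option backward.isDefEq.respectTransparency false in
/-- **(G1b) The `Ω`-point of the twisted model attached to `y^σ̃` lies over `Spec ι ≫ Spec σ̃ ≫ ξ_y`**: for the conjugate
datum `R'.conjOfSquares γ γᵥ h₁ p n h₂` (model `𝒳 ⊗_{γᵥ} 𝓞ᵥ`, generic isomorphism `(𝒳 ⊗_{γᵥ} 𝓞ᵥ)_K ≅ (𝒳_K)^γ ≅ A^γ`),
`σ̃ : K̄ ≃+* K̄` over `γ` (`hσa`), `y ∈ A(K̄)` with model point `ξ_y` (`hξ`) and its `σ̃`-conjugate
`y^σ̃ = conjTransport γ σ̃ hσa A y ∈ A^γ(K̄)`: the `Ω`-point of the twisted model attached to `y^σ̃` by the conjugate datum's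
reduction map, projected to `𝒳`, has underlying map `Spec (σ̃ then ι) ≫ ξ_y.left` — the hypothesis `hP'` of the slot (T3)
(«`x^σ̃` lies over `Spec σ̃ ≫ x`», [Shimura1998] p. 129). [cite: Shimura1998, §18.6 proof of Thm. 18.6, p. 129] -/
theorem modelPointsEquiv_symm_conjTransport_left_comp_fst [(adicCompletionPrime K v).IsMaximal]
    (f' : valuationSubringAtPrime K v →+* absIntegersValuationSubring (adicCompletionPrime K v)) (y : A.geomPoints)
    (ξ : specFractionField (absIntegersValuationSubring (adicCompletionPrime K v)) f' ⟶ R'.model.total)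
    (hξ : ξ.left = (Additive.toMul y ≫ R'.genericIso'.inv).left ≫
      pullback.fst R'.model.total.hom (specGenericPoint (valuationSubringAtPrime K v) K)) :
    ((R'.conjOfSquares γ γᵥ h₁ p n h₂).modelPointsEquiv.symm
          (toAdicCompletionPoints (A.conjugate γ) v (Additive.toMul (conjTransport γ σt hσa A y)))).left ≫
        baseChangeHomFst γᵥ.toRingHom R'.model.total =
      Spec.map (CommRingCat.ofHom ((absClosureEmbedding K (v.adicCompletion K)).toRingHom.comp σt.toRingHom)) ≫ ξ.left := by
  rw [modelPointsEquiv_symm_left, Over.comp_left, toAdicCompletionPoints_left, Category.assoc, Category.assoc, Category.assoc]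
  have hinv : ((R'.conjOfSquares γ γᵥ h₁ p n h₂).genericIso'.inv).left ≫
      pullback.fst ((R'.conjOfSquares γ γᵥ h₁ p n h₂).model.total).hom
          (specGenericPoint (valuationSubringAtPrime K v) K) ≫ baseChangeHomFst γᵥ.toRingHom R'.model.total =
        baseChangeHomFst γ.toRingHom A.X ≫ R'.model.genericIso.inv.left ≫
          baseChangeHomFst (algebraMap (valuationSubringAtPrime K v) K) R'.model.total :=
    conjModel_genericIso_inv_left_comp_fst_fst R' γ γᵥ h₁
  have h2 := congrArg ((Additive.toMul (conjTransport γ σt hσa A y)).left ≫ ·) hinv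
  have h3 : (Additive.toMul (conjTransport γ σt hσa A y)).left ≫ baseChangeHomFst γ.toRingHom A.X ≫
      R'.model.genericIso.inv.left ≫ baseChangeHomFst (algebraMap (valuationSubringAtPrime K v) K) R'.model.total =
        Spec.map (CommRingCat.ofHom σt.toRingHom) ≫ (Additive.toMul y).left ≫ R'.model.genericIso.inv.left ≫
          baseChangeHomFst (algebraMap (valuationSubringAtPrime K v) K) R'.model.total := by
    rw [← Category.assoc, conjTransport_left_comp_fst γ σt hσa A y, Category.assoc]
  refine (congrArg (Spec.map (CommRingCat.ofHom (absClosureEmbedding K (v.adicCompletion K)).toRingHom) ≫ ·)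
    (h2.trans h3)).trans ?_
  rw [hξ, Over.comp_left, CommRingCat.ofHom_comp, Spec.map_comp]
  simp only [Category.assoc]
  rfl

/-! #### The conjugate by an arithmetic Frobenius -/

set_option backward.isDefEq.respectTransparency false in
/-- **(G1b) for `GoodReductionAt.conjFrob`**: the same reading for the conjugate datum `R'.conjFrob γ hγ p n hq` of an
arithmetic Frobenius `γ ∈ Aut(K/F₀)` at `v` (`γᵥ = algEquivValuationSubring v γ _`, by unfolding `conjFrob`).
[cite: Shimura1998, §18.6 proof of Thm. 18.6, p. 129] -/
theorem modelPointsEquiv_symm_conjTransport_left_comp_fst_conjFrob {F₀ : Type} [Field F₀] [Algebra F₀ K]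
    [(adicCompletionPrime K v).IsMaximal] (γ : K ≃ₐ[F₀] K) (hγ : IsArithFrobAt (𝓞 F₀) γ v.asIdeal)
    (hq : Nat.card (𝓞 F₀ ⧸ v.asIdeal.under (𝓞 F₀)) = p ^ n) (σt : AlgebraicClosure K ≃+* AlgebraicClosure K)
    (hσa : ∀ a : K, σt (algebraMap K (AlgebraicClosure K) a) = algebraMap K (AlgebraicClosure K) (γ.toRingEquiv a))
    (f' : valuationSubringAtPrime K v →+* absIntegersValuationSubring (adicCompletionPrime K v)) (y : A.geomPoints)
    (ξ : specFractionField (absIntegersValuationSubring (adicCompletionPrime K v)) f' ⟶ R'.model.total)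
    (hξ : ξ.left = (Additive.toMul y ≫ R'.genericIso'.inv).left ≫
      pullback.fst R'.model.total.hom (specGenericPoint (valuationSubringAtPrime K v) K)) :
    ((R'.conjFrob γ hγ p n hq).modelPointsEquiv.symm
          (toAdicCompletionPoints (A.conjugate γ.toRingEquiv) v
            (Additive.toMul (conjTransport γ.toRingEquiv σt hσa A y)))).left ≫
        baseChangeHomFst (algEquivValuationSubring v γ (smul_asIdeal_eq_of_isArithFrobAt v γ hγ)).toRingHom
          R'.model.total =
      Spec.map (CommRingCat.ofHom ((absClosureEmbedding K (v.adicCompletion K)).toRingHom.comp σt.toRingHom)) ≫ ξ.left :=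
  modelPointsEquiv_symm_conjTransport_left_comp_fst R' γ.toRingEquiv
    (algEquivValuationSubring v γ (smul_asIdeal_eq_of_isArithFrobAt v γ hγ))
    (algebraMap_comp_algEquivValuationSubring v γ _) p n
    (residueAt_comp_algEquivValuationSubring v γ hγ p n hq) σt hσa f' y ξ hξ

end GoodReductionAt

end AbelianVariety

end Literature.AlgebraicGeometry.Motives

end
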